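import Mathlib
import Summits.NavierStokesRegularity.NavierStokesRegularity.Theorems.EulerZoomLiouvillePowerGaugeEulerLiouvilleSelfSimilarHighSetFlux
import Literature.Analysis.FluidPDE.SphereIntegral
import HarnessLib

/-!
# «JETS MUST TURN» ON EVERY SPHERE — the sphere form of the turning law (layer width `r → 0`, polar coordinates)
# (crux `EulerZoomLiouville.PowerGaugeEulerLiouville` = stmt-NavierStokesRegularity-19832, THE ONE STATEMENT `stub_selfSimilarC2Needle`, T2 face;
#  line `needle_faces` stub B «Q_in(r) ≤ Q_out(r) + 3γ·vol(high ∩ {|y| > r})» — here literally on the sphere `|y| = r`; width seat ns-ezl-w1 g5)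

Route №10 `EulerZoomLiouville` (NavierStokesRegularity).  The layer form `HighSetFlux.flux_turning_law` (`F_{R,r}(ω) ≥ −3γ·vol(far ω-set)`, `F_{R,r}(ω) =
∫ ω k_{R,r} ⟪x, W⟫`, `k_{R,r} = (2/(rR)) S′((R²−|x|²)/(rR))`) is passed to the limit `r → 0` with the tree's polar coordinates
(`Literature.Analysis.FluidPDE.sphereIntegral`, `integral_eq_integral_Ioi_sphereIntegral`):

* `flux_eq_integral_radialWeight` — `F_{R,r}(ω) = ∫_{ρ>0} w_{R,r}(ρ) · (ρ · sphereIntegral vol (ω ⟪·, W⟫) ρ) dρ` with the radial weight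
  `w_{R,r}(ρ) = ρ k_{R,r}(ρ) = −d/dρ S((R²−ρ²)/(rR)) ≥ 0`, supported in `R(R−r) ≤ ρ² ≤ R²`, of total mass `1` (`integral_radialWeight_eq_one`):
  the layer flux is an AVERAGE of the sphere fluxes `ρ ↦ ρ·∫_{S²} ω(ρα) ⟪ρα, W(ρα)⟫ dσ(α)` over the layer;
* **`sphere_flux_turning_law`** — for a `C²` self-similar Euler profile (centre `0`, `γ ≥ 0`, `A`-growth `θ_A < 2`), `ω ∈ C¹`, `0 ≤ ω ≤ 1`, non-increasing
  along `W`, and EVERY radius `R > 0` whose far `ω`-set beyond `R/2` has finite volume: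
  `R · sphereIntegral vol (fun x ↦ ω x ⟪x, W x⟫) R ≥ −3γ · vol({ω ≠ 0} ∩ {R ≤ |x|})`
  — i.e. `∫_{S²} ω(Rα) ⟪α, W(Rα)⟫ dσ(α) ≥ −3γ·vol(far ω-set)/R²`: ON EVERY SPHERE the `ω`-weighted similarity INFLOW flux is matched by OUTFLOW flux up
  to `3γ·vol({ω ≠ 0} ∩ {|x| ≥ R})` (continuity of the sphere flux in the radius + continuity from above of the far volumes; Mathlib's `toSphere` gives
  `σ(S²) = 4π`, so `R² · sphereIntegral` is the surface integral over `|x| = R`);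
* **`sphere_bernoulli_flux_turning_law`** — the instance `ω = S((ℋ_P − h)/η)` (`0 ≤ γ ≤ ½`): for every level `h` and radius `R > 0` with
  `vol({ℋ > h} ∩ {|x| ≥ R/2}) < ∞`:  `R·∫_{S²} S((ℋ−h)/η)(Rα) ⟪Rα, W(Rα)⟫ dσ(α) ≥ −3γ·vol({ℋ > h} ∩ {R ≤ |x|})`.

READING: this is the ideator's flux law exactly as drawn («Q_in(r) ≤ Q_out(r) + 3γ·vol(high ∩ {|y| > r})») and it pairs with the needle's per-sphere portrait
(N1) «every large sphere carries a vortical Bernoulli-high inflow point»: whenever the high inflow points of a sphere carry flux, the SAME sphere carries outflow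
high points (`s < γ`) of matching flux, up to `O(R^{−3−3ρ})/R` for class profiles.  HONEST LABEL: tool; nothing here excludes a needle.  WHAT THIS IS NOT: not NS,
not E — `--supports` stmt-19832 on the MODEL lattice; 19832 OPEN; NS regularity NOT proved. [folklore; ConstantinIgnatovaVicol2026Putative §3.4.1 (3.22)]
-/

noncomputable section

-- flat `Theorems/<Route><Decl>…` files of one crux share the namespace of the crux (tree convention)
set_option linter.dupNamespace false

open MeasureTheory Set Filter Topology Metric Function InnerProductSpace
open scoped RealInnerProductSpace NNReal ENNReal

namespace Summit.NavierStokesRegularity.NavierStokesRegularity.Theorems.PowerGaugeEulerLiouville.HighSetFlux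

open Literature.Analysis Literature.Analysis.FluidPDE

/-! ### The radial weight of a Tao layer -/

/-- Scalar form: `S′((R² − ρ²)/(rR)) = 0` for `ρ > R` (`0 < r`, `0 < R`). [folklore] -/
theorem deriv_smoothTransition_radial_eq_zero_of_lt {R r ρ : ℝ} (hr : 0 < r) (hR : 0 < R) (hρ : R < ρ) :
    deriv Real.smoothTransition ((R ^ 2 - ρ ^ 2) / (r * R)) = 0 := by
  have hs : (R ^ 2 - ρ ^ 2) / (r * R) < 0 :=
    div_neg_of_neg_of_pos (by nlinarith) (mul_pos hr hR)
  have hev : Real.smoothTransition =ᶠ[𝓝 ((R ^ 2 - ρ ^ 2) / (r * R))] fun _ => (0 : ℝ) := by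
    filter_upwards [Iio_mem_nhds hs] with y hy
    exact Real.smoothTransition.zero_of_nonpos (le_of_lt hy)
  rw [hev.deriv_eq, deriv_const]

/-- Scalar form: `S′((R² − ρ²)/(rR)) = 0` for `ρ² < R(R − r)` (`0 < r`, `0 < R`). [folklore] -/
theorem deriv_smoothTransition_radial_eq_zero_of_sq_lt {R r ρ : ℝ} (hr : 0 < r) (hR : 0 < R) (hρ : ρ ^ 2 < R * (R - r)) :
    deriv Real.smoothTransition ((R ^ 2 - ρ ^ 2) / (r * R)) = 0 := by
  have hs : 1 < (R ^ 2 - ρ ^ 2) / (r * R) := by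
    rw [lt_div_iff₀ (mul_pos hr hR)]; nlinarith
  have hev : Real.smoothTransition =ᶠ[𝓝 ((R ^ 2 - ρ ^ 2) / (r * R))] fun _ => (1 : ℝ) := by
    filter_upwards [Ioi_mem_nhds hs] with y hy
    exact Real.smoothTransition.one_of_one_le (le_of_lt hy)
  rw [hev.deriv_eq, deriv_const]

/-- The radial weight `w_{R,r}(ρ) = ρ (2/(rR)) S′((R²−ρ²)/(rR))` is non-negative for `ρ ≥ 0`. [folklore] -/
theorem radialWeight_nonneg {R r ρ : ℝ} (hr : 0 < r) (hR : 0 < R) (hρ : 0 ≤ ρ) :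
    0 ≤ ρ * (2 / (r * R) * deriv Real.smoothTransition ((R ^ 2 - ρ ^ 2) / (r * R))) :=
  mul_nonneg hρ (mul_nonneg (by positivity) Real.smoothTransition.monotone.deriv_nonneg)

/-- The radial weight is `−d/dρ S((R² − ρ²)/(rR))`. [folklore] -/
theorem hasDerivAt_neg_smoothTransition_radial (R r ρ : ℝ) :
    HasDerivAt (fun ρ : ℝ => -Real.smoothTransition ((R ^ 2 - ρ ^ 2) / (r * R)))
      (ρ * (2 / (r * R) * deriv Real.smoothTransition ((R ^ 2 - ρ ^ 2) / (r * R)))) ρ := by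
  have h1 : HasDerivAt (fun ρ : ℝ => (R ^ 2 - ρ ^ 2) / (r * R)) (-(2 * ρ) / (r * R)) ρ := by
    have := ((hasDerivAt_pow 2 ρ).const_sub (R ^ 2)).div_const (r * R)
    simpa using this
  have hS : HasDerivAt Real.smoothTransition (deriv Real.smoothTransition ((R ^ 2 - ρ ^ 2) / (r * R)))
      ((R ^ 2 - ρ ^ 2) / (r * R)) :=
    ((Real.smoothTransition.contDiff (n := 1)).differentiable one_ne_zero _).hasDerivAt
  have h := (hS.comp ρ h1).neg
  refine h.congr_deriv ?_
  field_simp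

/-- **The radial weight has total mass one**: `∫_{ρ>0} w_{R,r}(ρ) dρ = 1` (`0 < r ≤ R`; the weight vanishes for `ρ > R` and
`−S((R²−ρ²)/(rR))` runs from `−S(R/r) = −1` at `ρ = 0` to `−S(0) = 0` at `ρ = R`). [folklore] -/
theorem integral_radialWeight_eq_one {R r : ℝ} (hr : 0 < r) (hrR : r ≤ R) :
    ∫ ρ in Ioi (0 : ℝ), ρ * (2 / (r * R) * deriv Real.smoothTransition ((R ^ 2 - ρ ^ 2) / (r * R))) = 1 := by
  have hR : 0 < R := hr.trans_le hrR
  set w : ℝ → ℝ := fun ρ => ρ * (2 / (r * R) * deriv Real.smoothTransition ((R ^ 2 - ρ ^ 2) / (r * R))) with hwdef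
  have hwc : Continuous w :=
    continuous_id.mul (continuous_const.mul (((Real.smoothTransition.contDiff (n := 1)).continuous_deriv le_rfl).comp
      ((continuous_const.sub (continuous_pow 2)).div_const _)))
  -- split `(0, ∞) = (0, R] ∪ (R, ∞)`; the weight vanishes on `(R, ∞)`
  rw [← Ioc_union_Ioi_eq_Ioi hR.le, setIntegral_union (Ioc_disjoint_Ioi le_rfl) measurableSet_Ioi
    (hwc.integrableOn_Icc.mono_set Ioc_subset_Icc_self) ?_]
  · have hzero : ∫ ρ in Ioi R, w ρ = 0 := by
      have h0 : ∫ ρ in Ioi R, w ρ = ∫ ρ in Ioi R, (0 : ℝ) :=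
        setIntegral_congr_fun measurableSet_Ioi fun ρ hρ => by
          show w ρ = 0
          rw [hwdef]; simp only [deriv_smoothTransition_radial_eq_zero_of_lt hr hR hρ, mul_zero]
      rw [h0, integral_zero]
    rw [hzero, add_zero, ← intervalIntegral.integral_of_le hR.le,
      intervalIntegral.integral_eq_sub_of_hasDerivAt (fun ρ _ => hasDerivAt_neg_smoothTransition_radial R r ρ)
        (hwc.intervalIntegrable 0 R)]
    simp only [sub_self, zero_div, ne_eq, OfNat.ofNat_ne_zero, not_false_eq_true, zero_pow, sub_zero]
    rw [Real.smoothTransition.zero_of_nonpos le_rfl, show R ^ 2 / (r * R) = R / r by field_simp,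
      Real.smoothTransition.one_of_one_le ((one_le_div hr).2 hrR)]
    ring
  · -- integrability on `(R, ∞)`: the weight is zero there
    refine IntegrableOn.congr_fun (f := fun _ : ℝ => (0 : ℝ)) integrableOn_zero (fun ρ hρ => ?_) measurableSet_Ioi
    show (0 : ℝ) = w ρ
    rw [hwdef]; simp only [deriv_smoothTransition_radial_eq_zero_of_lt hr hR hρ, mul_zero]

/-! ### The layer flux as an average of sphere fluxes -/

section Sphere

variable {γ : ℝ} {U : EuclideanSpace ℝ (Fin 3) → EuclideanSpace ℝ (Fin 3)} {P : EuclideanSpace ℝ (Fin 3) → ℝ}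

/-- **The layer flux is an average of sphere fluxes** (polar coordinates): for continuous `ω`, `W` and `0 < r ≤ R`,
`∫ ω·(−Dθ_{R,r}[W]) = ∫_{ρ>0} w_{R,r}(ρ) · (ρ · sphereIntegral vol (ω⟪·, W⟫) ρ) dρ`, `w_{R,r}(ρ) = ρ k_{R,r}(ρ)`. [folklore] -/
theorem flux_eq_integral_radialWeight {ω : EuclideanSpace ℝ (Fin 3) → ℝ} (hωc : Continuous ω) (hU : Continuous U)
    {R r : ℝ} (hr : 0 < r) (hrR : r ≤ R) :
    (∫ x, ω x * -(fderiv ℝ (taoCutoff R r) x (selfSimilarTransport γ 0 U x))) =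
      ∫ ρ in Ioi (0 : ℝ), (ρ * (2 / (r * R) * deriv Real.smoothTransition ((R ^ 2 - ρ ^ 2) / (r * R)))) *
        (ρ * sphereIntegral volume (fun x => ω x * ⟪x, selfSimilarTransport γ 0 U x⟫) ρ) := by
  set W : EuclideanSpace ℝ (Fin 3) → EuclideanSpace ℝ (Fin 3) := selfSimilarTransport γ 0 U with hWdef
  have hWc : Continuous W := (((continuous_id.sub continuous_const).const_smul γ).add hU :)
  -- the integrand in kernel form
  set f : EuclideanSpace ℝ (Fin 3) → ℝ := fun x => ω x * -(fderiv ℝ (taoCutoff R r) x (W x)) with hfdef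
  have hfint : Integrable f := by
    have h := (integrable_mul_fderiv_taoCutoff_apply hωc hWc hr hrR).neg
    refine h.congr (Eventually.of_forall fun x => ?_)
    simp only [hfdef, Pi.neg_apply]
    ring
  rw [integral_eq_integral_Ioi_sphereIntegral volume hfint, finrank_euclideanSpace_fin]
  refine setIntegral_congr_fun measurableSet_Ioi fun ρ hρ => ?_
  have hρ0 : 0 < ρ := hρ
  -- on the sphere of radius `ρ` the kernel is the constant `k(ρ)`
  have hsph : sphereIntegral volume f ρ =
      (2 / (r * R) * deriv Real.smoothTransition ((R ^ 2 - ρ ^ 2) / (r * R))) *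
        sphereIntegral volume (fun x => ω x * ⟪x, W x⟫) ρ := by
    rw [sphereIntegral_def, sphereIntegral_def, ← integral_const_mul]
    refine integral_congr_ae (ae_of_all _ fun α => ?_)
    rw [hfdef]
    simp only
    rw [fderiv_taoCutoff_apply, norm_smul_sphere hρ0.le α]
    ring
  rw [hsph]
  simp only [smul_eq_mul]
  norm_num
  ring

/-- **THE TURNING LAW ON EVERY SPHERE.**  Let `(U, P)` be a `C²` self-similar Euler profile on `ℝ³` (centre `0`, `γ ≥ 0`) with the `A`-growth
`∫_{B̄_L}‖U‖² ≤ c_A L^{θ_A}` (`L ≥ 1`, `θ_A < 2`); `ω ∈ C¹`, `0 ≤ ω ≤ 1`, non-increasing along `W = γy + U`; `R > 0` with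
`vol({ω ≠ 0} ∩ {R²/2 ≤ |x|²}) < ∞`.  Then

  `R · sphereIntegral vol (fun x ↦ ω x ⟪x, W x⟫) R ≥ −3γ · vol({ω ≠ 0} ∩ {R² ≤ |x|²})`,

i.e. `∫_{S²} ω(Rα)⟪α, W(Rα)⟫ dσ(α) ≥ −3γ vol(far ω-set)/R²`: on every sphere the `ω`-weighted similarity INFLOW flux is matched by OUTFLOW flux up to
`3γ ×` the `ω`-volume beyond the sphere.  Proof: the layer law `flux_turning_law` for `θ_{R,r}`, `F_{R,r}` = average of `ρ ↦ ρ·sphereIntegral(…) ρ` over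
`[√(R(R−r)), R]` (`flux_eq_integral_radialWeight`, `integral_radialWeight_eq_one`), continuity of the sphere integral in the radius
(`continuous_sphereIntegral`) and continuity from above of the far volumes as `r → 0`. [folklore; ConstantinIgnatovaVicol2026Putative §3.4.1 (3.22)] -/
theorem sphere_flux_turning_law (hprof : IsSelfSimilarEulerProfile γ 0 U P) (hγ : 0 ≤ γ)
    {ω : EuclideanSpace ℝ (Fin 3) → ℝ} (hω : ContDiff ℝ 1 ω) (hω0 : ∀ x, 0 ≤ ω x) (hω1 : ∀ x, ω x ≤ 1)
    (hanti : ∀ x, fderiv ℝ ω x (selfSimilarTransport γ 0 U x) ≤ 0)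
    {cA θA : ℝ} (hθA : θA < 2)
    (hA : ∀ L : ℝ, 1 ≤ L → ∫ x in closedBall (0 : EuclideanSpace ℝ (Fin 3)) L, ‖U x‖ ^ 2 ≤ cA * L ^ θA)
    {R : ℝ} (hR : 0 < R)
    (hfin : volume ({x : EuclideanSpace ℝ (Fin 3) | ω x ≠ 0} ∩ {x | R ^ 2 / 2 ≤ ‖x‖ ^ 2}) < ∞) :
    -(3 * γ * (volume ({x : EuclideanSpace ℝ (Fin 3) | ω x ≠ 0} ∩ {x | R ^ 2 ≤ ‖x‖ ^ 2})).toReal) ≤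
      R * sphereIntegral volume (fun x => ω x * ⟪x, selfSimilarTransport γ 0 U x⟫) R := by
  set W : EuclideanSpace ℝ (Fin 3) → EuclideanSpace ℝ (Fin 3) := selfSimilarTransport γ 0 U with hWdef
  set G : EuclideanSpace ℝ (Fin 3) → ℝ := fun x => ω x * ⟪x, W x⟫ with hGdef
  set Φ : ℝ → ℝ := fun ρ => ρ * sphereIntegral volume G ρ with hΦdef
  set S : ℝ → Set (EuclideanSpace ℝ (Fin 3)) := fun s => {x | ω x ≠ 0} ∩ {x | s ≤ ‖x‖ ^ 2} with hSdef
  have hUc : Continuous U := hprof.contDiff_velocity.continuous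
  have hωc : Continuous ω := hω.continuous
  have hWc : Continuous W := (((continuous_id.sub continuous_const).const_smul γ).add hUc :)
  have hGc : Continuous G := hωc.mul (continuous_id.inner hWc)
  have hΦc : Continuous Φ := continuous_id.mul (continuous_sphereIntegral volume hGc)
  have hSm : ∀ s, MeasurableSet (S s) := fun s =>
    (isOpen_ne_fun hωc continuous_const).measurableSet.inter (isClosed_le continuous_const (continuous_norm.pow 2)).measurableSet
  have hSmono : ∀ s t, s ≤ t → S t ⊆ S s := fun s t hst x hx => ⟨hx.1, le_trans hst hx.2⟩
  -- the far volumes are continuous from above at `R²` along `r ↓ 0`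
  set v : ℝ → ℝ := fun s => (volume (S s)).toReal with hvdef
  set rseq : ℕ → ℝ := fun n => R / (n + 2) with hrseq
  have hrpos : ∀ n, 0 < rseq n := fun n => by rw [hrseq]; positivity
  have hrle : ∀ n, rseq n ≤ R / 2 := fun n => by
    rw [hrseq]
    have hn0 : (0 : ℝ) ≤ n := Nat.cast_nonneg n
    exact div_le_div_of_nonneg_left hR.le (by norm_num) (by linarith)
  have hsub_half : ∀ n, S (R * (R - rseq n)) ⊆ S (R ^ 2 / 2) := fun n =>
    hSmono _ _ (by nlinarith [hrle n, hrpos n])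
  have hfin_n : ∀ n, volume (S (R * (R - rseq n))) < ∞ := fun n => (measure_mono (hsub_half n)).trans_lt hfin
  have hlim_v : Tendsto (fun n => v (R * (R - rseq n))) atTop (𝓝 (v (R ^ 2))) := by
    have hanti : Antitone fun n => S (R * (R - rseq n)) := by
      intro m n hmn
      refine hSmono _ _ ?_
      have h1 : rseq n ≤ rseq m := by
        rw [hrseq]; exact div_le_div_of_nonneg_left hR.le (by positivity) (by simpa using hmn)
      nlinarith
    have hinter : (⋂ n, S (R * (R - rseq n))) = S (R ^ 2) := by
      ext x
      simp only [mem_iInter]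
      constructor
      · intro hx
        refine ⟨(hx 0).1, ?_⟩
        show R ^ 2 ≤ ‖x‖ ^ 2
        -- `R(R − R/(n+2)) ≤ ‖x‖²` for all `n` ⇒ `R² ≤ ‖x‖²`
        by_contra hlt
        rw [not_le] at hlt
        obtain ⟨n, hn⟩ := exists_nat_gt (R ^ 2 / (R ^ 2 - ‖x‖ ^ 2))
        have hx2 : R * (R - rseq n) ≤ ‖x‖ ^ 2 := (hx n).2
        have hpos : 0 < R ^ 2 - ‖x‖ ^ 2 := by linarith
        have hn0 : (0 : ℝ) ≤ n := Nat.cast_nonneg n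
        have h1 : R * rseq n * (n + 2 : ℝ) = R ^ 2 := by rw [hrseq]; field_simp
        have h2 : R ^ 2 - ‖x‖ ^ 2 ≤ R * rseq n := by nlinarith
        have h3 : R ^ 2 < (n : ℝ) * (R ^ 2 - ‖x‖ ^ 2) := by
          have := (div_lt_iff₀ hpos).1 hn; linarith
        have h4 : (R ^ 2 - ‖x‖ ^ 2) * (n + 2 : ℝ) ≤ R * rseq n * (n + 2 : ℝ) :=
          mul_le_mul_of_nonneg_right h2 (by linarith)
        rw [h1] at h4
        nlinarith
      · intro hx n
        have hx2 : R ^ 2 ≤ ‖x‖ ^ 2 := hx.2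
        refine ⟨hx.1, ?_⟩
        show R * (R - rseq n) ≤ ‖x‖ ^ 2
        nlinarith [hrpos n, hR]
    have hmeas := tendsto_measure_iInter_atTop (μ := volume) (fun n => (hSm _).nullMeasurableSet) hanti ⟨0, (hfin_n 0).ne⟩
    rw [hinter] at hmeas
    have hne : volume (S (R ^ 2)) ≠ ∞ := ((measure_mono (hSmono _ _ (by nlinarith) : S (R ^ 2) ⊆ S (R ^ 2 / 2))).trans_lt hfin).ne
    exact (ENNReal.tendsto_toReal hne).comp hmeas
  -- main argument: `Φ R ≥ −3γ v(R²) − 2ε` for every `ε > 0`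
  have hmain : ∀ ε : ℝ, 0 < ε → -(3 * γ * v (R ^ 2)) - 2 * ε ≤ Φ R := by
    intro ε hε
    by_contra hlt
    rw [not_le] at hlt
    -- (i) continuity of `Φ` at `R`
    have hev : ∀ᶠ ρ in 𝓝 R, Φ ρ < -(3 * γ * v (R ^ 2)) - ε :=
      hΦc.continuousAt.eventually (gt_mem_nhds (by linarith))
    obtain ⟨δ, hδ, hball⟩ := Metric.eventually_nhds_iff.1 hev
    -- (ii) volumes and small layer width along the sequence
    have hεq : 0 < ε / (3 * γ + 1) := by positivity
    have hv_ev : ∀ᶠ n : ℕ in atTop, v (R * (R - rseq n)) < v (R ^ 2) + ε / (3 * γ + 1) :=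
      hlim_v (Iio_mem_nhds (by linarith))
    have hr_ev : ∀ᶠ n : ℕ in atTop, rseq n < min δ R := by
      have ht : Tendsto rseq atTop (𝓝 0) := by
        rw [hrseq]
        have h1 : Tendsto (fun n : ℕ => ((n : ℝ) + 2)) atTop atTop :=
          tendsto_atTop_add_const_right _ _ tendsto_natCast_atTop_atTop
        exact h1.const_div_atTop R
      exact ht (Iio_mem_nhds (lt_min hδ hR))
    obtain ⟨n, hvn, hrn⟩ := (hv_ev.and hr_ev).exists
    set r : ℝ := rseq n with hrdef
    have hr0 : 0 < r := hrpos n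
    have hrδ : r < δ := hrn.trans_le (min_le_left _ _)
    have hrR : r ≤ R := (hrn.trans_le (min_le_right _ _)).le
    -- (iii) the layer flux is an average of `Φ` over `[√(R(R−r)), R] ⊆ (R − δ, R]`
    set w : ℝ → ℝ := fun ρ => ρ * (2 / (r * R) * deriv Real.smoothTransition ((R ^ 2 - ρ ^ 2) / (r * R))) with hwdef
    have hwc : Continuous w :=
      continuous_id.mul (continuous_const.mul (((Real.smoothTransition.contDiff (n := 1)).continuous_deriv le_rfl).comp
        ((continuous_const.sub (continuous_pow 2)).div_const _)))
    have hF := flux_eq_integral_radialWeight (γ := γ) hωc hUc hr0 hrR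
    have hwsupp : ∀ ρ, 0 < ρ → w ρ ≠ 0 → R * (R - r) ≤ ρ ^ 2 ∧ ρ ≤ R := by
      intro ρ hρ hw
      by_contra hnot
      rw [not_and_or, not_le, not_le] at hnot
      apply hw
      rcases hnot with h1 | h2
      · rw [hwdef]; simp only [deriv_smoothTransition_radial_eq_zero_of_sq_lt hr0 hR h1, mul_zero]
      · rw [hwdef]; simp only [deriv_smoothTransition_radial_eq_zero_of_lt hr0 hR h2, mul_zero]
    have hΦ_on : ∀ ρ, 0 < ρ → w ρ ≠ 0 → Φ ρ ≤ -(3 * γ * v (R ^ 2)) - ε := by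
      intro ρ hρ hw
      obtain ⟨h1, h2⟩ := hwsupp ρ hρ hw
      have hρR : dist ρ R < δ := by
        rw [Real.dist_eq, abs_sub_comm, abs_of_nonneg (by linarith)]
        -- `R − ρ ≤ r < δ` since `ρ² ≥ R(R−r) ≥ (R−r)²`
        have : (R - r) ^ 2 ≤ ρ ^ 2 := by nlinarith
        have hρge : R - r ≤ ρ := by
          by_contra hc
          rw [not_le] at hc
          by_cases hs : 0 ≤ R - r
          · nlinarith
          · linarith
        linarith
      exact (hball hρR).le
    -- integrability on `(0, ∞)` (continuous, vanishing beyond `R`)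
    have hint_w : IntegrableOn w (Ioi 0) := by
      rw [← Ioc_union_Ioi_eq_Ioi hR.le]
      refine (hwc.integrableOn_Icc.mono_set Ioc_subset_Icc_self).union ?_
      refine IntegrableOn.congr_fun (f := fun _ : ℝ => (0 : ℝ)) integrableOn_zero (fun ρ hρ => ?_) measurableSet_Ioi
      show (0 : ℝ) = w ρ
      rw [hwdef]; simp only [deriv_smoothTransition_radial_eq_zero_of_lt hr0 hR hρ, mul_zero]
    have hint_wΦ : IntegrableOn (fun ρ => w ρ * Φ ρ) (Ioi 0) := by
      rw [← Ioc_union_Ioi_eq_Ioi hR.le]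
      refine ((hwc.mul hΦc).integrableOn_Icc.mono_set Ioc_subset_Icc_self).union ?_
      refine IntegrableOn.congr_fun (f := fun _ : ℝ => (0 : ℝ)) integrableOn_zero (fun ρ hρ => ?_) measurableSet_Ioi
      show (0 : ℝ) = w ρ * Φ ρ
      rw [hwdef]; simp only [deriv_smoothTransition_radial_eq_zero_of_lt hr0 hR hρ, mul_zero, zero_mul]
    have hFle : (∫ x, ω x * -(fderiv ℝ (taoCutoff R r) x (W x))) ≤ -(3 * γ * v (R ^ 2)) - ε := by
      rw [hF]
      have hle : (∫ ρ in Ioi (0 : ℝ), w ρ * Φ ρ) ≤ ∫ ρ in Ioi (0 : ℝ), w ρ * (-(3 * γ * v (R ^ 2)) - ε) := by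
        refine setIntegral_mono_on hint_wΦ (hint_w.mul_const _) measurableSet_Ioi fun ρ hρ => ?_
        by_cases hw : w ρ = 0
        · rw [hw, zero_mul, zero_mul]
        · exact mul_le_mul_of_nonneg_left (hΦ_on ρ hρ hw) (radialWeight_nonneg hr0 hR (le_of_lt hρ))
      refine hle.trans ?_
      rw [integral_mul_const, integral_radialWeight_eq_one hr0 hrR, one_mul]
    -- (iv) the layer turning law contradicts this
    have hfin_r : volume ({x : EuclideanSpace ℝ (Fin 3) | ω x ≠ 0} ∩ {x | R * (R - r) ≤ ‖x‖ ^ 2}) < ∞ := hfin_n n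
    have hlaw := flux_turning_law hprof hγ hω hω0 hω1 hanti hθA hA hr0 hrR hfin_r
    have hvn' : 3 * γ * v (R * (R - r)) ≤ 3 * γ * v (R ^ 2) + 3 * γ * (ε / (3 * γ + 1)) := by
      have := mul_le_mul_of_nonneg_left hvn.le (by positivity : (0 : ℝ) ≤ 3 * γ)
      linarith
    have hfrac : 3 * γ * (ε / (3 * γ + 1)) < ε := by
      rw [mul_div_assoc', div_lt_iff₀ (by positivity)]; nlinarith
    have : -(3 * γ * v (R * (R - r))) ≤ ∫ x, ω x * -(fderiv ℝ (taoCutoff R r) x (W x)) := hlaw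
    linarith
  -- conclude
  have : -(3 * γ * v (R ^ 2)) ≤ Φ R := by
    refine le_of_forall_pos_lt_add fun ε hε => ?_
    have := hmain (ε / 4) (by positivity)
    linarith
  simpa [hΦdef, hvdef, hSdef] using this

/-- **THE TURNING LAW ON EVERY SPHERE FOR BERNOULLI HIGH SETS.**  `(U, P)` a `C²` self-similar Euler profile on `ℝ³` (centre `0`, `0 ≤ γ ≤ ½`) with the
`A`-growth `θ_A < 2`; `h` a level, `η > 0`, `R > 0` with `vol({ℋ > h} ∩ {R²/2 ≤ |x|²}) < ∞`.  Then
`R · ∫_{S²} S((ℋ(Rα)−h)/η) ⟪Rα, W(Rα)⟫ dσ(α) ≥ −3γ · vol({ℋ > h} ∩ {R² ≤ |x|²})`: on EVERY sphere the inflow flux of the (smoothed) high set is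
matched by outflow flux up to `3γ·vol(high beyond the sphere)` (`≲ R^{−3−3ρ}` for class profiles). [folklore; ConstantinIgnatovaVicol2026Putative §3.4.1 (3.22)] -/
theorem sphere_bernoulli_flux_turning_law (hprof : IsSelfSimilarEulerProfile γ 0 U P) (hγ0 : 0 ≤ γ) (hγ : γ ≤ 1 / 2)
    {cA θA : ℝ} (hθA : θA < 2)
    (hA : ∀ L : ℝ, 1 ≤ L → ∫ x in closedBall (0 : EuclideanSpace ℝ (Fin 3)) L, ‖U x‖ ^ 2 ≤ cA * L ^ θA)
    (h : ℝ) {η : ℝ} (hη : 0 < η) {R : ℝ} (hR : 0 < R)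
    (hfin : volume ({x : EuclideanSpace ℝ (Fin 3) | h < selfSimilarBernoulli γ 0 U P x} ∩ {x | R ^ 2 / 2 ≤ ‖x‖ ^ 2}) < ∞) :
    -(3 * γ * (volume ({x : EuclideanSpace ℝ (Fin 3) | h < selfSimilarBernoulli γ 0 U P x} ∩ {x | R ^ 2 ≤ ‖x‖ ^ 2})).toReal) ≤
      R * sphereIntegral volume (fun x => Real.smoothTransition ((selfSimilarBernoulli γ 0 U P x - h) / η) *
        ⟪x, selfSimilarTransport γ 0 U x⟫) R := by
  set ω : EuclideanSpace ℝ (Fin 3) → ℝ := fun x => Real.smoothTransition ((selfSimilarBernoulli γ 0 U P x - h) / η) with hωdef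
  have hsub : ∀ s : ℝ, {x : EuclideanSpace ℝ (Fin 3) | ω x ≠ 0} ∩ {x | s ≤ ‖x‖ ^ 2} ⊆
      {x | h < selfSimilarBernoulli γ 0 U P x} ∩ {x | s ≤ ‖x‖ ^ 2} := fun s =>
    inter_subset_inter_left _ (bernoulliWeight_ne_zero_subset h hη)
  have hfin' : volume ({x : EuclideanSpace ℝ (Fin 3) | ω x ≠ 0} ∩ {x | R ^ 2 / 2 ≤ ‖x‖ ^ 2}) < ∞ :=
    (measure_mono (hsub _)).trans_lt hfin
  have hlaw := sphere_flux_turning_law hprof hγ0 (contDiff_bernoulliWeight hprof h) (fun x => Real.smoothTransition.nonneg _)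
    (fun x => Real.smoothTransition.le_one _) (fderiv_bernoulliWeight_transport_nonpos hprof hγ h hη) hθA hA hR hfin'
  have hfinR : volume ({x : EuclideanSpace ℝ (Fin 3) | h < selfSimilarBernoulli γ 0 U P x} ∩ {x | R ^ 2 ≤ ‖x‖ ^ 2}) < ∞ :=
    (measure_mono (inter_subset_inter_right _ (fun x (hx : R ^ 2 ≤ ‖x‖ ^ 2) => show R ^ 2 / 2 ≤ ‖x‖ ^ 2 by
      have : 0 ≤ R ^ 2 := sq_nonneg R; linarith))).trans_lt hfin
  have hmono : (volume ({x : EuclideanSpace ℝ (Fin 3) | ω x ≠ 0} ∩ {x | R ^ 2 ≤ ‖x‖ ^ 2})).toReal ≤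
      (volume ({x : EuclideanSpace ℝ (Fin 3) | h < selfSimilarBernoulli γ 0 U P x} ∩ {x | R ^ 2 ≤ ‖x‖ ^ 2})).toReal :=
    ENNReal.toReal_mono hfinR.ne (measure_mono (hsub _))
  have h3 := mul_le_mul_of_nonneg_left hmono (by positivity : (0 : ℝ) ≤ 3 * γ)
  linarith

end Sphere

end Summit.NavierStokesRegularity.NavierStokesRegularity.Theorems.PowerGaugeEulerLiouville.HighSetFlux

end
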